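import Summits.BirchSwinnertonDyer.BirchSwinnertonDyer.Theorems.PrintCf2RubinValueTwoRowTwoTwistedKummerClass
import Summits.BirchSwinnertonDyer.BirchSwinnertonDyer.Theorems.PrintCf2RubinValueTwoRowTwoLevelTorsion
import Mathlib.Tactic.Group
import HarnessLib

/-!
# M-LINE-PIN / (α3) ROW 2, FILE 3h: the TWISTED conjugation law — `γ · κ(β) = θ(γ) · κ(γβ)` for EVERY `γ ∈ Γ_K`

Cell `bsd-print-cf2`, WIDTH seat `bsd-line-cf2-p1-w6` g9 (prover-bsd-line-cf2-p1-w6-g9-0), successor of g8 on (α3) ROW 2 of the JLK road on the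
DECIDING child stmt-BirchSwinnertonDyer-24721 `PrintCf2RubinValueTwo.MainConjClauseAtSplitTwoQuadDA` (memo `HOME/bsd-line-cf2-p1-w6/ROW2-SPEC-w6g8.md`
(R2-5)/(R2-7); successor item ρ3 — the kernel of the units-side map — and -w5 g9's F0b antecedent (KC-θ) «general θ-scalar conj law (generalize
p725114)», `HOME/bsd-line-cf2-p1-w5/F0B-ASSEMBLY-PLAN-w5g9.md`); `--supports` that item (helper, Theses-free). HONEST FRAMING: cohomological
bookkeeping over ty2's predicate `JohnsonLeungKings2011.IsTwistedKummerClass`; nothing here closes the crux or a registered stub; no summit statement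
is proved by this seat; BSD is not proved by any of this. THEOREMS ONLY (no definition, no named fact, no instance, no `sorry`).

WHAT. g8's FILE 3d (`isTwistedKummerClass_levelConj`, p725114) is the conjugation law for `γ` with `θ(γ) = 1`: `γ·c` is a class of `γβ`. For a
GENERAL `γ ∈ Γ_K` the `t_p(θ)`-twist shows up as a scalar (JLK §3.3 (5): "`κ(gu) ⊗ t = θ(g)⁻¹ · g⋆(κ(u) ⊗ t)`", transcription note (T3) of ty2's
carriers file): on cocycles `(γ·φ)(σ) = γ ⋆ φ(γ⁻¹σγ) = (σ(γβ)/(γβ))^{θ(γ) mod p^k}`, so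

* **`levelConj_eq_nsmul_of_isTwistedKummerClass`**: if `c` is a class of `β` and `c'` a class of `γ•β` (both at the normal level `U`), then
  `γ·c = (θ(γ) mod p^k) • c'` in `H¹(G_S(F), μ_{p^k} ⊗ θ)` (the scalar named by `(charModPow p θ k γ).val : ℕ`);
* **`levelConj_eq_neg_of_isTwistedKummerClass`**: for `θ(γ) = −1` (the non-trivial element of `Gal(K_θ/K)` for a quadratic `θ`), `γ·c = −c'` —
  the sign by which `res ∘ cor = 1 + δ` acts as `κ(u) ↦ κ(u) − κ(δu) = κ(u/δu)` on the Kummer classes of `F_n = K_θK̃_n` over `K̃_n` ((R2-5): on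
  Rubin's `θ`-eigenclasses `[δu] = −[u]`, so `res ∘ cor` is multiplication by `2` up to elliptic units — the `2`-power slack of ROW 2's kernel).

presearch: «Galois action on Kummer classes twisted by a character, κ(gu)⊗t = θ(g)⁻¹ g(κ(u)⊗t)» → JLK 2011 §3.3 (5) [corpus: arXiv 0804.2828 p0010
L61–70] states it; folklore cocycle computation (Serre, *Local Fields* VII §5). beyond-print theorem: no.

References: J. Johnson-Leung, G. Kings, J. reine angew. Math. 653 (2011) §3.3 (5)–(6); J.-P. Serre, *Local Fields* (1979) VII §5, X §3 b).
-/

noncomputable section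

open scoped Classical

-- the summit namespace `Summit.BirchSwinnertonDyer.BirchSwinnertonDyer` repeats the problem name by design (D-0017)
set_option linter.dupNamespace false
set_option autoImplicit false

open scoped NumberField
open Field IsDedekindDomain
open Literature.NumberTheory.GaloisRepresentations Literature.NumberTheory.GaloisRepresentations.DiscreteGaloisModule
open Literature.NumberTheory.EllipticCurves (subgroupConj)
open Literature.NumberTheory.ComplexMultiplication.EllipticUnits.JohnsonLeungKings2011

namespace Summit.BirchSwinnertonDyer.BirchSwinnertonDyer.Theorems.PrintCf2.RowTwo

variable {K : Type} [Field K] [NumberField K] (p : ℕ) [Fact p.Prime] (S : Set (HeightOneSpectrum (𝓞 K)))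
  (θ : absoluteGaloisGroup K →ₜ* ℤ_[p]ˣ) (U : Subgroup (absoluteGaloisGroup K)) [U.Normal] (k : ℕ)

omit [NumberField K] in
/-- **THE TWISTED CONJUGATION LAW** (`U ⊴ Γ_K`, ANY `γ ∈ Γ_K`): if `c ∈ H¹(G_S(F), μ_{p^k} ⊗ θ)` is a twisted Kummer class of `β` and `c'` one of
`γ•β`, then `γ·c = (θ(γ) mod p^k) • c'` — on cocycles `(γ·φ)(σ) = γ ⋆ φ(γ⁻¹σγ) = (γ((γ⁻¹σγ)β/β))^{θ(γ)} = (σ(γβ)/(γβ))^{θ(γ)}`. JLK §3.3 (5):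
"`κ(gu) ⊗ t = θ(g)⁻¹ · g⋆(κ(u) ⊗ t)`". [cite: JohnsonLeungKings2011, §3.3 (5) (arXiv p0010:L61–70)] [cite: SerreLocalFields1979, VII §5] -/
theorem levelConj_eq_nsmul_of_isTwistedKummerClass {β : (AlgebraicClosure K)ˣ} {c c' : levelCoh p S θ U k 1}
    (hc : IsTwistedKummerClass p θ S U k β c) (γ : absoluteGaloisGroup K) (hc' : IsTwistedKummerClass p θ S U k (γ • β) c') :
    levelConj p S θ U k 1 γ c = (charModPow p θ k γ).val • c' := by
  haveI hN : (imGS S U).Normal := Subgroup.Normal.map inferInstance _ (toUnramifiedQuot_surjective K S)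
  obtain ⟨φ₀, rfl, hφ⟩ := hc
  obtain ⟨φ₀', rfl, hφ'⟩ := hc'
  let X := (coeffGS p S θ k).toTopRep
  let g : GaloisGroupUnramifiedOutside K S := toUnramifiedQuot K S γ
  let φ : contOneCocycles (subgroupRep X (imGS S U)) := φ₀
  let φ' : contOneCocycles (subgroupRep X (imGS S U)) := φ₀'
  let ψ : contOneCocycles (subgroupRep X (imGS S U)) :=
    contOneCocycles.pullback (subgroupConj (imGS S U) g) (conjRepHom X (imGS S U) g) φ
  -- the conjugated cocycle IS `N • φ'`, `N = θ(γ) mod p^k`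
  have hψ : ψ = (charModPow p θ k γ).val • φ' := by
    refine Subtype.ext (ContinuousMap.ext fun x ↦ ?_)
    obtain ⟨σ, hσ, hσx⟩ := exists_lift_mem S U x
    have hσ' : γ⁻¹ * σ * γ ∈ U := by
      have h := Subgroup.Normal.conj_mem inferInstance σ hσ γ⁻¹
      rwa [inv_inv] at h
    have hconj : subgroupConj (imGS S U) g x = (⟨toUnramifiedQuot K S (γ⁻¹ * σ * γ), Subgroup.mem_map_of_mem _ hσ'⟩ : imGS S U) := by
      apply Subtype.ext
      change g⁻¹ * (x : GaloisGroupUnramifiedOutside K S) * g = toUnramifiedQuot K S (γ⁻¹ * σ * γ)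
      rw [← hσx, map_mul, map_mul, map_inv]
    have hφ'x : muVal K (p ^ k) ((φ'.1 x :
        Representation.invariants ((muTwist p θ k).toRepresentation.comp (ramificationSubgroup K S).subtype)) : MuCarrier K (p ^ k)) =
        σ • (γ • β) / (γ • β) := by
      have h := hφ' σ hσ
      rwa [show (⟨toUnramifiedQuot K S σ, Subgroup.mem_map_of_mem _ hσ⟩ : imGS S U) = x from Subtype.ext hσx] at h
    apply Subtype.ext
    apply muVal_injective K (p ^ k)
    change muVal K (p ^ k) (muTwist p θ k γ
      ((φ.1 (subgroupConj (imGS S U) g x) :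
          Representation.invariants ((muTwist p θ k).toRepresentation.comp (ramificationSubgroup K S).subtype)) :
        MuCarrier K (p ^ k))) =
      muVal K (p ^ k) ((charModPow p θ k γ).val • ((φ'.1 x :
          Representation.invariants ((muTwist p θ k).toRepresentation.comp (ramificationSubgroup K S).subtype)) : MuCarrier K (p ^ k)))
    rw [hconj, muVal_muTwist_apply, muVal_apply, hφ _ hσ', muVal_nsmul, hφ'x, smul_div', ← mul_smul, ← mul_smul,
      show γ * (γ⁻¹ * σ * γ) = σ * γ by group, mul_smul]
  change (conjMap X (imGS S U) g 1).hom (oneCocycleClass _ φ) = (charModPow p θ k γ).val • oneCocycleClass _ φ'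
  rw [conjMap_oneCocycleClass]
  change oneCocycleClass _ ψ = _
  rw [hψ, ← oneCocycleClassₗ_apply, map_nsmul, oneCocycleClassₗ_apply]

omit [NumberField K] in
/-- **`θ(γ) = −1`: `γ·c = −c'`** (`c` a class of `β`, `c'` a class of `γβ`; `−1 ≡ p^k − 1 (mod p^k)` and `p^k·c' = 0`). For a quadratic `θ` and
`γ ∉ ker θ` this is the sign in `res_{F_n} ∘ cor_{F_n→K̃_n} = 1 + δ`, `F_n = K_θK̃_n` ((R2-5)).
[cite: JohnsonLeungKings2011, §3.3 (5) (arXiv p0010:L61–70)] [cite: SerreLocalFields1979, VII §5] -/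
theorem levelConj_eq_neg_of_isTwistedKummerClass {β : (AlgebraicClosure K)ˣ} {c c' : levelCoh p S θ U k 1}
    (hc : IsTwistedKummerClass p θ S U k β c) (γ : absoluteGaloisGroup K) (hγ : θ γ = -1)
    (hc' : IsTwistedKummerClass p θ S U k (γ • β) c') : levelConj p S θ U k 1 γ c = -c' := by
  haveI : NeZero (p ^ k) := ⟨pow_ne_zero _ (Fact.out : p.Prime).ne_zero⟩
  rw [levelConj_eq_nsmul_of_isTwistedKummerClass p S θ U k hc γ hc']
  have hval : charModPow p θ k γ = -1 := by
    rw [charModPow_apply, hγ, Units.val_neg, Units.val_one, map_neg, map_one]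
  -- `N + 1 ≡ 0 (mod p^k)` for `N = (θ(γ) mod p^k).val`, and `p^k • c' = 0`
  have hdvd : p ^ k ∣ (charModPow p θ k γ).val + 1 := by
    rw [← ZMod.natCast_eq_zero_iff, Nat.cast_add, Nat.cast_one, ZMod.natCast_zmod_val, hval, neg_add_cancel]
  obtain ⟨t, ht⟩ := hdvd
  have h1 : ((charModPow p θ k γ).val + 1) • c' = 0 := by
    rw [ht, mul_nsmul, nsmul_levelCoh_one_eq_zero p S θ U k c', nsmul_zero]
  rw [add_nsmul, one_nsmul] at h1
  exact eq_neg_of_add_eq_zero_left h1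

end Summit.BirchSwinnertonDyer.BirchSwinnertonDyer.Theorems.PrintCf2.RowTwo

end
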